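import Summits.ABC.IUTFork.Repair.RHHeightClassKLineCert5
import HarnessLib

/-!
# R-H row 8 «heightclass» — Q3 HEX «NO l UNIFORM IN k» BY NAME: at EVERY prime `l ≥ 11` some `λ_k` (here `k = 30·j`, `ε = 1`, `m_q = 30j`) is OUT of Σ₈
Companion of `RHHeightClassKLine` (p476616) and the K-line tables `RHHeightClassKLineCert*` (p477144…p478450); seat abc-iut-rh-typ-8 gen 4; rung
LADDER-ABC:A2.RESCUE.H; booked word ROUND2 Q3 HEX «YES-PER-DATUM-NOT-UNIFORM … NO l uniform in k» (B4, rh-lead g2 22:50Z). PROOF-ONLY (0 definitions).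
The sub-family `k = 30j` has `ε(k) = 30/gcd(30,k) = 1`, so its K-line type at the prime `l` is `(7, e_w = l)`, `m_q = k·ε = 30j`, top label `l⋆ = (l−1)/2`.
Theorem `exists_mult30_not_sigma8`: for every prime `l ≥ 11` there is `j ≥ 1` such that the row-8 top cell FAILS at the untied `r♯(7, l)` for `k = 30j` —
below `l ≤ 4747561509857` the table row `k = 30` (`lambda30_out_sigma8_of_le_4747561509857`) serves, above it `j := t⋆ + 1` with `t⋆` the minimiser of
`t ↦ 7^t − t·l` and abc-iut-rh2-q3-typ-1's `not_hexSlice_of_k_ge` (`k ≥ 2t⋆+3`, `l⋆ ≥ 3t⋆+4` — the latter from `7^{t⋆} ≤ 1 + t⋆·l`). Hence no prime `l` puts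
every `λ_k` in Σ₈: the l₀⁸(k) column is unbounded BY THEOREM, not only by the forty computed rows. TAKES NO SIDE on [IUTchIII] Cor. 3.12 or on any author;
nothing here asserts abc; `HBand`/`StrictMinPow` are row 8's CANDIDATE vocabulary (hypotheses); «out of Σ₈» = the hypothesis's own clause fails at the integer
data (by `exists_certVal_cell_iff` this is the typed clause at such a place). [claim: Mochizuki2012, status: disputed] for the reading; the arithmetic is [folklore].
-/

namespace Summit.ABC.IUTFork.Repair.RHHeightClass.KLine

open Summit.ABC.IUTFork.Repair.RHHeightClass Summit.ABC.IUTFork.Repair.RH.Q3LTailBand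

/-- `7^t > 6t² + 7t + 1` for `t ≥ 3` (so `7^t ≤ 1 + t·l` forces `l ≥ 6t + 8` once `t ≥ 3`). [folklore] -/
theorem seven_pow_gt_quad {t : ℕ} (ht : 3 ≤ t) : 6 * (t : ℤ) ^ 2 + 7 * t + 1 < (7 : ℤ) ^ t := by
  induction t with
  | zero => omega
  | succ n ih =>
    rcases Nat.lt_or_ge n 3 with h | h
    · have hn2 : n = 2 := by omega
      subst hn2
      norm_num
    · have := ih h
      push_cast at this ⊢
      have hn : (3 : ℤ) ≤ n := by exact_mod_cast h
      rw [show (7 : ℤ) ^ (n + 1) = 7 ^ n * 7 from pow_succ 7 n]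
      nlinarith

/-- **The minimiser is small against the label count.** If `r = 7^t − t·l` is the strict minimum (`StrictMinPow 7 l r`, so `r ≤ 1`) and `l ≥ 21`, then
`3t + 4 ≤ l⋆ = l/2` (else `l ≤ 6t + 7` and `7^t ≤ 1 + t·l ≤ 6t² + 7t + 1`, impossible for `t ≥ 3`; `t ≤ 2` would give `l ≤ 19`). [folklore] -/
theorem three_mul_add_four_le_half {l t : ℕ} {r : ℤ} (hr : StrictMinPow 7 l r) (ht : (7 : ℤ) ^ t - t * l = r) (h21 : 21 ≤ l) :
    3 * t + 4 ≤ l / 2 := by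
  have hr1 : r ≤ 1 := strictMinPow_le_one hr
  by_contra hlt
  have hl : (l : ℤ) ≤ 6 * t + 7 := by
    have : l ≤ 6 * t + 7 := by omega
    exact_mod_cast this
  have ht0 : (0 : ℤ) ≤ t := by positivity
  have key : (7 : ℤ) ^ t ≤ 6 * (t : ℤ) ^ 2 + 7 * t + 1 := by nlinarith
  rcases Nat.lt_or_ge t 3 with h3 | h3
  · -- t ≤ 2 ⟹ l ≤ 19 < 21
    have : l ≤ 6 * t + 7 := by omega
    omega
  · exact absurd key (not_le.2 (seven_pow_gt_quad h3))

/-- **«NO l UNIFORM IN k» (row 8, λ_k K-line, sub-family `k = 30j`, `ε = 1`).** For every prime `l ≥ 11` there is `j ≥ 1` such that for the untied strict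
minimum `r♯(7, l)` (which exists: `exists_strictMinPow_kline`, `7 < 11 ≤ l`) the row-8 top cell with `m_q = 30j` FAILS:
`¬ (l⋆²−1)·(30j) ≤ l⋆·(l − r♯) + (1 − r♯)`. Witness: `j = 1` for `l ≤ 4747561509857` (kernel table row `k = 30`), else `j = t⋆ + 1`. [folklore] -/
theorem exists_mult30_not_sigma8 {l : ℕ} (hl : l.Prime) (h11 : 11 ≤ l) :
    (∃ r : ℤ, StrictMinPow 7 (l * 1) r) ∧
      ∃ j : ℕ, 1 ≤ j ∧ ∀ r : ℤ, StrictMinPow 7 (l * 1) r →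
        ¬ ((((l / 2 : ℕ) : ℤ)) ^ 2 - 1) * ((30 * (j : ℤ)) * 1) ≤ ((l / 2 : ℕ) : ℤ) * (((l * 1 : ℕ) : ℤ) - r) + (1 - r) := by
  refine ⟨exists_strictMinPow_kline (p := 7) (by norm_num) hl (by omega) 1, ?_⟩
  have hodd : l % 2 = 1 := Nat.odd_iff.1 (hl.odd_of_ne_two (by omega))
  rcases Nat.lt_or_ge l 4747561509858 with hsmall | hbig
  · refine ⟨1, le_rfl, fun r hr h => ?_⟩
    refine lambda30_out_sigma8_of_le_4747561509857 hl h11 (by omega) r hr ?_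
    simpa using h
  · -- the minimiser `t⋆` of `t ↦ 7^t − t·l` and `j := t⋆ + 1`
    obtain ⟨r₀, hr₀⟩ := exists_strictMinPow_kline (p := 7) (by norm_num) hl (by omega) 1
    obtain ⟨t, ht, hmin⟩ := hr₀
    refine ⟨t + 1, by omega, fun r hr h => ?_⟩
    have hrr : r = r₀ := strictMinPow_unique hr ⟨t, ht, hmin⟩
    subst hrr
    have hl1 : l * 1 = l := by omega
    have ht' : (7 : ℤ) ^ t - t * l = r := by simpa [hl1] using ht
    have hls : 3 * t + 4 ≤ l / 2 := three_mul_add_four_le_half (by simpa [hl1] using hr) ht' (by omega)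
    have hcast : ((l * 1 : ℕ) : ℤ) = (2 * ((l / 2 : ℕ) : ℤ) + 1) * 1 := by omega
    rw [hcast] at h
    have hT : (0 : ℤ) ≤ (t : ℤ) := by positivity
    have hrT : -((t : ℤ) * ((2 * ((l / 2 : ℕ) : ℤ) + 1 : ℤ) * 1)) ≤ r := by
      have h7 : (0 : ℤ) ≤ (7 : ℤ) ^ t := by positivity
      have hl' : ((l : ℤ)) = 2 * ((l / 2 : ℕ) : ℤ) + 1 := by omega
      rw [← ht', hl']
      nlinarith
    have hls' : 3 * (t : ℤ) + 4 ≤ ((l / 2 : ℕ) : ℤ) := by exact_mod_cast hls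
    have hk : 2 * (t : ℤ) + 3 ≤ 30 * ((t + 1 : ℕ) : ℤ) := by push_cast; omega
    exact not_hexSlice_of_k_ge (k := 30 * ((t + 1 : ℕ) : ℤ)) (ε := 1) (T := (t : ℤ)) (ls := l / 2) le_rfl hT hrT hls' hk h

end Summit.ABC.IUTFork.Repair.RHHeightClass.KLine
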